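import Literature.Geometry.DiscreteGeometry.ShellCensusReplayGraph
import HarnessLib

/-!
# Text format for census certificates with contact-graph leaves

Topic `Literature/Geometry/DiscreteGeometry`; companion of `ShellCensusReplayGraph.lean` (replayer
extension #4, stub `stub_linkCensus` of crux `SquareWellLayerCake.GapTwelveToBarlow`,
stmt-AtomisticToContinuum-15807): the decoder `GCensus.ofText` of a graph census shipped as a
string of integers, reusing the tokenizer and readers of `ShellCensusReplay.lean` (`Text.tokens`,
`natAt`, `intAt`, `readNats`, `readConstraints`) and the tree decoder `Text.decodeLTree` of
`ShellCensusReplayLPText.lean` for embedded infeasibility certificates. Grammar (prefix, all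
tokens integers):

* census := `E` entry₁ … entry_E; entry := `L` (k l b)ᴸ gtree (`b ∈ {0,1}`: far/bond);
* gtree := `0 k l` gtree gtree (case) ∣ `1` ltree (sub; `ltree` in the grammar of `LCensus.ofText`)
  ∣ `2 L π₀…π_{L−1} j` (dead) ∣ `3 L π₀…π_{L−1} j` (same) ∣ `4 L π₀…π_{L−1} j` (good).

The degree window, the facet labels, the infeasible context, the targets and the wanted list are
ARGUMENTS of `GCensus.check`, not data. Malformed input decodes to the empty census, which fails
every check; the decoder needs no correctness proof. `toyGCensus_decode` reads the toy census of
the companion file back from its token form in the kernel.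
-/

namespace Literature.Geometry.DiscreteGeometry

namespace ShellCensus

namespace Text

/-- Decode a graph-census tree at position `i` (`fuel` bounds the depth). [folklore] -/
def decodeGTree (ts : Array ℤ) : ℕ → ℕ → Option (GTree × ℕ)
  | 0, _ => none
  | fuel + 1, i =>
    let tag := intAt ts i
    if tag = 0 then
      match decodeGTree ts fuel (i + 3) with
      | none => none
      | some (tb, j) =>
        match decodeGTree ts fuel j with
        | none => none
        | some (tf, j') => some (.case (natAt ts (i + 1)) (natAt ts (i + 2)) tb tf, j')
    else if tag = 1 then
      match decodeLTree ts (ts.size + 1) (i + 1) with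
      | none => none
      | some (t, j) => some (.sub t, j)
    else if tag = 2 then
      let r := readNats ts (natAt ts (i + 1)) (i + 2)
      some (.dead r.1 (natAt ts r.2), r.2 + 1)
    else if tag = 3 then
      let r := readNats ts (natAt ts (i + 1)) (i + 2)
      some (.same r.1 (natAt ts r.2), r.2 + 1)
    else if tag = 4 then
      let r := readNats ts (natAt ts (i + 1)) (i + 2)
      some (.good r.1 (natAt ts r.2), r.2 + 1)
    else none

/-- Decode `count` graph-census entries from position `i`. [folklore] -/
def decodeGEntries (ts : Array ℤ) : ℕ → ℕ → Option GCensus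
  | 0, _ => some []
  | count + 1, i =>
    let r := readConstraints ts (natAt ts i) (i + 1)
    match decodeGTree ts (ts.size + 1) r.2 with
    | none => none
    | some (t, j) =>
      match decodeGEntries ts count j with
      | none => none
      | some rest => some ((r.1, t) :: rest)

end Text

/-- **Decode a graph census from its text form** (the empty census on malformed input). [folklore] -/
def GCensus.ofText (s : String) : GCensus :=
  let ts := Text.tokens s
  (Text.decodeGEntries ts (Text.natAt ts 0) 1).getD []

/-- The token form of `toyGCensus` (grammar of `GCensus.ofText`). [folklore] -/
def toyGToks : Array ℤ :=
  #[2, 0, 0, 0, 1, 4, 3, 0, 1, 2, 0, 2, 3, 0, 1, 2, 0,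
    1, 2, 1, 1, 0, 0, 2, 1, 8, 0, 3, 3, 1, 0, 2, 0]

/-- The decoder reads the token form of the toy graph census back; as `GTree` has no decidable
equality through `LTree`-free means here, we compare the checker's verdicts instead: the decoded
census passes the same check (kernel evaluation). [folklore] -/
theorem toyGCensus_decode :
    GCensus.check toyLSpec 0 0 none #[[(0, 1, false)]] #[[(0, 1, true)]] [(2, 1, true)]
      ((Text.decodeGEntries toyGToks (Text.natAt toyGToks 0) 1).getD []) = true := by
  decide +kernel

end ShellCensus

end Literature.Geometry.DiscreteGeometry
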